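import Mathlib
import Summits.NavierStokesRegularity.NavierStokesRegularity.Theorems.FilamentSkeletonRssStadiumOwnReal

/-!
# Real agreement of the OWN-filament contour at height `0` (`TangentSkeletonNearStraightL`, stmt-NavierStokesRegularity-23320, registered stub
# `stub_stripPropagation` — blueprint item R5′ of `DIAG-addendum2-landed-g2.md`)

At a real target `t` the retyped own-filament contour degenerates to the real axis: the two connectors are `∫_0^0 = 0`, the plateau lies at height `0`
where its sources `F(σ)`, `F′(σ)` ARE `cplx X(σ)`, `cplx X′(σ)` (Theorems.StadiumDeviationPackage.deriv_real_point), and the far set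
`{P ≤ |σ − c|}` is the complement of the open plateau interval.  Hence (`own_contour_real`):
  `∫_{P ≤ |σ−c|} K_X(t,σ) dσ + ∫_{c−P}^{c+P} K_F(t,σ) dσ = cplx ( ∫_ℝ ((‖X t − X σ‖² + κA σ)^{3/2})⁻¹ • cross (X′σ) (X t − X σ) dσ )`,
the `k = j` summand of the stub's `u X (X j t)` — via Theorems.StadiumOwnReal (integrability, `kernel_real`), `integral_add_compl`, `Ioo =ᵐ Ioc` and
`ContinuousLinearMap.integral_comp_comm`.  HONEST FRAMING: bookkeeping for a HYPOTHETICAL filament skeleton on the NEGATIVE side of a MODEL route;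
nothing here bears on Navier–Stokes regularity or blow-up.  `--supports stmt-NavierStokesRegularity-23320`.
-/

set_option linter.dupNamespace false

noncomputable section

namespace Summit.NavierStokesRegularity.NavierStokesRegularity.Theorems.StadiumOwnRealTotal

open Set Metric MeasureTheory
open scoped InnerProductSpace Matrix
open Literature.Analysis.FluidPDE
open Summit.NavierStokesRegularity.NavierStokesRegularity.Theorems.StadiumPartnerReal
open Summit.NavierStokesRegularity.NavierStokesRegularity.Theorems.StadiumOwnReal
open Summit.NavierStokesRegularity.NavierStokesRegularity.Theorems.StadiumDeviationPackage

/-- **Real agreement of the own contour at height `0`.**  See the module docstring. [folklore] -/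
theorem own_contour_real {hs L cc κ Λ P : ℝ} {F : ℂ → (Fin 3 → ℂ)} {X : ℝ → EuclideanSpace ℝ (Fin 3)}
    (hF : DifferentiableOn ℂ F {z : ℂ | |z.im| < hs ∧ |z.re - cc| < L + hs})
    (hFX : ∀ r : ℝ, (r : ℂ) ∈ {z : ℂ | |z.im| < hs ∧ |z.re - cc| < L + hs} →
      F r = fun i => ((⟪X r, EuclideanSpace.single i (1:ℝ)⟫_ℝ : ℝ) : ℂ))
    (hX : ContDiff ℝ 1 X) (hXu : ∀ σ, ‖deriv X σ‖ = 1) (hosc : ∀ τ σ, ‖deriv X τ - deriv X σ‖ ≤ 1 / 2)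
    {A : ℝ → ℝ} (hAc : Continuous A) (hΛ : 0 < Λ) (hA : ∀ σ, Λ⁻¹ ≤ A σ) (hκ : 0 < κ)
    (hhs : 0 < hs) (hP : 0 < P) (hPtr : P < L + hs) {t : ℝ} (ht : |t - cc| < L + hs) :
    (∫ σ in {σ : ℝ | P ≤ |σ - cc|}, (((∑ i, (F t i - ((X σ i : ℝ) : ℂ)) ^ 2) + ((κ * A σ : ℝ) : ℂ)) ^ ((3:ℂ) / 2))⁻¹ •
        ((fun i => ((deriv X σ i : ℝ) : ℂ)) ⨯₃ (fun i => F t i - ((X σ i : ℝ) : ℂ)))) +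
    (∫ σ in (cc - P)..(cc + P), (((∑ i, (F t i - F σ i) ^ 2) + ((κ * A σ : ℝ) : ℂ)) ^ ((3:ℂ) / 2))⁻¹ •
        (deriv F σ ⨯₃ (fun i => F t i - F σ i))) =
      fun i => (((∫ σ : ℝ, ((‖X t - X σ‖ ^ 2 + κ * A σ) ^ (3/2 : ℝ))⁻¹ • cross (deriv X σ) (X t - X σ)) i : ℝ) : ℂ) := by
  have hXd : Differentiable ℝ X := hX.differentiable (by simp)
  set KX : ℝ → (Fin 3 → ℂ) := fun σ => (((∑ i, (F t i - ((X σ i : ℝ) : ℂ)) ^ 2) + ((κ * A σ : ℝ) : ℂ)) ^ ((3:ℂ) / 2))⁻¹ •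
        ((fun i => ((deriv X σ i : ℝ) : ℂ)) ⨯₃ (fun i => F t i - ((X σ i : ℝ) : ℂ))) with hKX
  set f : ℝ → EuclideanSpace ℝ (Fin 3) := fun σ => ((‖X t - X σ‖ ^ 2 + κ * A σ) ^ (3/2 : ℝ))⁻¹ • cross (deriv X σ) (X t - X σ) with hf
  -- the complexification as a CLM and `KX = Lc ∘ f`
  set Lc : EuclideanSpace ℝ (Fin 3) →L[ℝ] (Fin 3 → ℂ) :=
    ContinuousLinearMap.pi fun i => Complex.ofRealCLM.comp (EuclideanSpace.proj i) with hLc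
  have hLc_apply : ∀ v : EuclideanSpace ℝ (Fin 3), Lc v = fun i => ((v i : ℝ) : ℂ) := by
    intro v; funext i; simp [hLc]
  have htS : ((t : ℝ) : ℂ) ∈ {z : ℂ | |z.im| < hs ∧ |z.re - cc| < L + hs} := ⟨by simpa using hhs, by simpa using ht⟩
  have hFt : ∀ i, F t i = ((X t i : ℝ) : ℂ) := by
    intro i; rw [hFX t htS]; simp only [inner_single_eq]
  have hA0 : ∀ σ, 0 ≤ A σ := fun σ => le_trans (by positivity) (hA σ)
  have hKXf : ∀ σ, KX σ = Lc (f σ) := by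
    intro σ
    have h := kernel_real (X t) X hκ.le hA0 σ
    simp only [← hFt] at h
    rw [hLc_apply]; exact h
  have hfint : Integrable f := integrable_own_real_kernel hX hXu hosc hAc hΛ hA hκ t
  have hKXint : Integrable KX := by
    have : KX = fun σ => Lc (f σ) := funext hKXf
    rw [this]; exact Lc.integrable_comp hfint
  -- the plateau at height 0 is the `X`-form integrand on the open interval
  have hplat : ∫ σ in (cc - P)..(cc + P), (((∑ i, (F t i - F σ i) ^ 2) + ((κ * A σ : ℝ) : ℂ)) ^ ((3:ℂ) / 2))⁻¹ •
        (deriv F σ ⨯₃ (fun i => F t i - F σ i)) = ∫ σ in Set.Ioo (cc - P) (cc + P), KX σ := by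
    rw [intervalIntegral.integral_of_le (by linarith), ← setIntegral_congr_set Ioo_ae_eq_Ioc]
    refine setIntegral_congr_fun measurableSet_Ioo fun σ hσ => ?_
    have hσtr : |σ - cc| < L + hs := by rw [abs_lt]; constructor <;> linarith [hσ.1, hσ.2]
    have hσS : ((σ : ℝ) : ℂ) ∈ {z : ℂ | |z.im| < hs ∧ |z.re - cc| < L + hs} := ⟨by simpa using hhs, by simpa using hσtr⟩
    have hFσ : F σ = fun i => ((X σ i : ℝ) : ℂ) := by rw [hFX σ hσS]; funext i; rw [inner_single_eq]
    have hF'σ : deriv F (σ : ℂ) = fun i => ((deriv X σ i : ℝ) : ℂ) := by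
      funext i
      have h := deriv_real_point hF hXd hFX hhs hσtr i
      rw [inner_single_eq] at h
      apply Complex.ext
      · rw [h.1]; simp
      · rw [h.2]; simp
    simp only [hKX, hFσ, hF'σ]
  -- far set = complement of the open plateau interval
  have hcompl : {σ : ℝ | P ≤ |σ - cc|} = (Set.Ioo (cc - P) (cc + P))ᶜ := by
    ext σ
    simp only [mem_setOf_eq, mem_compl_iff, mem_Ioo, not_and, not_lt]
    constructor
    · intro h h1
      rcases le_abs'.1 h with h2 | h2 <;> linarith
    · intro h
      by_contra h3
      have h3 : |σ - cc| < P := lt_of_not_ge h3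
      rw [abs_lt] at h3
      have := h (by linarith [h3.1])
      linarith [h3.2]
  rw [hplat, hcompl, add_comm, integral_add_compl measurableSet_Ioo hKXint]
  -- `∫ KX = Lc (∫ f)`
  have : (fun σ => KX σ) = fun σ => Lc (f σ) := funext hKXf
  rw [show (∫ σ, KX σ) = ∫ σ, Lc (f σ) by rw [this], Lc.integral_comp_comm hfint, hLc_apply]

end Summit.NavierStokesRegularity.NavierStokesRegularity.Theorems.StadiumOwnRealTotal

end
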